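import Mathlib.MeasureTheory.Integral.MeanInequalities
import Mathlib.MeasureTheory.Integral.Lebesgue.Countable
import Literature.Analysis.FunctionSpaces.TorusSobolevNorm
import HarnessLib

/-!
# Discharged facts: additivity of the spectral Sobolev scale `H^s(T^d)`

`Literature.Analysis.FunctionSpaces.TorusSobolevNorm` records three *elementary* closure
properties of the spectral Sobolev norm `‖f‖_{H^s} = (∑_k ⟨k⟩^{2s} ‖f̂(k)‖²)^{1/2}` as named
facts (`def … : Prop`), because their interim proofs depended on each other. They are proved
here, so that users holding `(h : Torus.eSobolevNorm_add_le)` etc. can discharge the hypothesis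
by `Torus.eSobolevNorm_add_le_holds`:

* `Torus.eSobolevNorm_add_le_holds` — the triangle inequality
  `‖f + g‖_{H^s} ≤ ‖f‖_{H^s} + ‖g‖_{H^s}` for integrable `f, g` (Minkowski's inequality in the
  weighted `ℓ²` space over `ℤ^d`, i.e. `MeasureTheory.ENNReal.lintegral_Lp_add_le` for the
  counting measure, after `𝓕(f+g) = 𝓕f + 𝓕g`);
* `Torus.MemSobolev.add_holds` — `H^s` is closed under addition;
* `Torus.MemSobolev.sub_holds` — `H^s` is closed under subtraction;
* `Torus.ContinuousInSobolevOn.memL2Sobolev_holds` — `C⁰([a,b]; H^s) ⊆ L²(a,b; H^s)`: a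
  continuous-in-time `H^s` family on a compact interval is bounded in `H^s`
  (`Torus.ContinuousInSobolevOn.exists_forall_eSobolevNorm_le`, compactness + the triangle
  inequality), hence square integrable in time on the finite interval `(a,b)`.

The proofs live in a separate file because `TorusSobolevNorm.lean` still carries
migration-only `[cite pending]` tags on its Parseval and embedding facts.

## References

* L. Grafakos, *Classical Fourier Analysis*, 3rd ed., GTM 249 (2014), §3.1.1 (linearity of
  Fourier coefficients), §3.3.
* R. Temam, *Navier–Stokes Equations and Nonlinear Functional Analysis*, 2nd ed., CBMS-NSF 66
  (1995), Part I §§2–3 (function spaces; the classes `L^p(0,T; X)`, `C([0,T]; X)`).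
  [TemamNSNFA1995]
-/

open MeasureTheory Set Filter Topology UnitAddTorus
open scoped ENNReal NNReal

noncomputable section

namespace Literature.Analysis.FunctionSpaces

namespace Torus

variable {d : Type*} [Fintype d]
variable {F : Type*} [NormedAddCommGroup F] [NormedSpace ℂ F]

/-- The Fourier integrand `e^{-2πi k·x} • f x` of an integrable `f` is integrable (the character
has norm one), for Mathlib's local Haar volume on `T^d`. [folklore] -/
theorem integrable_mFourier_smul {f : UnitAddTorus d → F} (hf : Integrable f volume)
    (k : d → ℤ) :
    Integrable (fun x => mFourier (-k) x • f x)
      (Measure.pi fun _ : d => AddCircle.haarAddCircle) := by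
  have hf' : Integrable f (Measure.pi fun _ : d => AddCircle.haarAddCircle) :=
    volume_eq_pi_haarAddCircle (d := d) ▸ hf
  exact hf'.bdd_smul 1 (mFourier (-k)).continuous.aestronglyMeasurable
    (Filter.Eventually.of_forall fun x =>
      ((mFourier (-k)).norm_coe_le_norm x).trans_eq mFourier_norm)

/-- Fourier coefficients are additive on integrable functions:
`𝓕(f + g)(k) = 𝓕f(k) + 𝓕g(k)` (Grafakos, Prop. 3.2.6 (1)). Integrability is needed: the
coefficients are Bochner integrals with junk value `0`. [cite: Grafakos2014, Prop. 3.2.6 (1)] -/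
theorem mFourierCoeff_add {f g : UnitAddTorus d → F} (hf : Integrable f volume)
    (hg : Integrable g volume) (k : d → ℤ) :
    mFourierCoeff (f + g) k = mFourierCoeff f k + mFourierCoeff g k := by
  simp only [mFourierCoeff, Pi.add_apply, smul_add]
  exact integral_add (integrable_mFourier_smul hf k) (integrable_mFourier_smul hg k)

/-- The `H^s` norm as an `L²` norm for the counting measure on `ℤ^d`:
`‖f‖_{H^s} = (∫⁻_{count} (⟨k⟩^s ‖f̂(k)‖)²)^{1/2}`. [folklore] -/
theorem eSobolevNorm_eq_lintegral_count (s : ℝ) (f : UnitAddTorus d → F) :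
    eSobolevNorm s f =
      (∫⁻ k, (fun k => ENNReal.ofReal (sobolevWeight s k) * ‖mFourierCoeff f k‖ₑ) k ^ (2 : ℝ)
        ∂Measure.count) ^ (1 / (2 : ℝ)) := by
  rw [lintegral_count, eSobolevNorm]
  congr 1
  refine tsum_congr fun k => ?_
  rw [ENNReal.rpow_two, mul_pow, ENNReal.ofReal_pow (sobolevWeight_pos s k).le]

/-- Discharge of the named fact `Torus.eSobolevNorm_add_le`: the triangle inequality
`‖f + g‖_{H^s} ≤ ‖f‖_{H^s} + ‖g‖_{H^s}` for integrable `f, g` — Minkowski's inequality in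
`ℓ²(ℤ^d)` applied to `k ↦ ⟨k⟩^s ‖f̂(k)‖`, after `𝓕(f+g) = 𝓕f + 𝓕g` and
`‖a + b‖ ≤ ‖a‖ + ‖b‖` (Grafakos, §3.3). [folklore] -/
theorem eSobolevNorm_add_le_holds : eSobolevNorm_add_le (d := d) (F := F) := by
  intro s f g hf hg
  simp only [eSobolevNorm_eq_lintegral_count]
  calc (∫⁻ k, (ENNReal.ofReal (sobolevWeight s k) * ‖mFourierCoeff (f + g) k‖ₑ) ^ (2 : ℝ)
          ∂Measure.count) ^ (1 / (2 : ℝ))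
      ≤ (∫⁻ k, ((fun k => ENNReal.ofReal (sobolevWeight s k) * ‖mFourierCoeff f k‖ₑ) +
            (fun k => ENNReal.ofReal (sobolevWeight s k) * ‖mFourierCoeff g k‖ₑ)) k ^ (2 : ℝ)
          ∂Measure.count) ^ (1 / (2 : ℝ)) := by
        gcongr with k
        rw [Pi.add_apply, ← mul_add, mFourierCoeff_add hf hg]
        gcongr
        exact enorm_add_le _ _
    _ ≤ _ := ENNReal.lintegral_Lp_add_le (Measurable.of_discrete.aemeasurable)
          (Measurable.of_discrete.aemeasurable) (by norm_num)

/-- Discharge of the named fact `Torus.MemSobolev.add`: `H^s` is closed under addition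
(integrability adds, and the norm of the sum is finite by the triangle inequality). [folklore] -/
theorem MemSobolev.add_holds : MemSobolev.add (d := d) (F := F) :=
  fun hf hg => ⟨hf.1.add hg.1,
    (eSobolevNorm_add_le_holds hf.1 hg.1).trans_lt (ENNReal.add_lt_top.2 ⟨hf.2, hg.2⟩)⟩

/-- Discharge of the named fact `Torus.MemSobolev.sub`: `H^s` is closed under subtraction
(`f - g = f + (-g)`). [folklore] -/
theorem MemSobolev.sub_holds : MemSobolev.sub (d := d) (F := F) := by
  intro s f g hf hg
  simpa [sub_eq_add_neg] using MemSobolev.add_holds hf hg.neg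

/-! ## `C⁰([a,b]; H^s) ⊆ L²(a,b; H^s)` -/

/-- A `C⁰(S; H^s(T^d))` family on a *compact* time set `S` is bounded in `H^s`: there is `C < ∞`
with `‖v t‖_{H^s} ≤ C` for every `t ∈ S` (a continuous function on a compact set is bounded).
Since `t ↦ v t` is only continuous for the extended seminorm `eSobolevNorm s` (not a map into a
normed space), the proof runs `IsCompact.induction_on` directly: near `t₀ ∈ S`,
`‖v t‖_{H^s} ≤ ‖v t - v t₀‖_{H^s} + ‖v t₀‖_{H^s} ≤ 1 + ‖v t₀‖_{H^s}` by the triangle inequality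
`Torus.eSobolevNorm_add_le_holds` (standard; cf. Temam 1995, Part I §§2–3, the classes
`L^p(0,T; X)`, `C([0,T]; X)` of the energy spaces). [folklore] -/
theorem ContinuousInSobolevOn.exists_forall_eSobolevNorm_le {S : Set ℝ} {s : ℝ}
    {v : ℝ → UnitAddTorus d → F} (hv : ContinuousInSobolevOn S s v) (hS : IsCompact S) :
    ∃ C : ℝ≥0∞, C < ∞ ∧ ∀ t ∈ S, eSobolevNorm s (v t) ≤ C := by
  refine hS.induction_on
    (p := fun S' => ∃ C : ℝ≥0∞, C < ∞ ∧ ∀ t ∈ S', eSobolevNorm s (v t) ≤ C)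
    ⟨0, ENNReal.zero_lt_top, fun t ht => (Set.notMem_empty t ht).elim⟩ ?_ ?_ ?_
  · rintro S₁ S₂ h ⟨C, hC, hle⟩
    exact ⟨C, hC, fun t ht => hle t (h ht)⟩
  · rintro S₁ S₂ ⟨C₁, hC₁, h₁⟩ ⟨C₂, hC₂, h₂⟩
    refine ⟨max C₁ C₂, max_lt hC₁ hC₂, fun t ht => ?_⟩
    rcases ht with h | h
    · exact (h₁ t h).trans (le_max_left _ _)
    · exact (h₂ t h).trans (le_max_right _ _)
  · intro t₀ ht₀
    have h₀ : MemSobolev s (v t₀) := hv.1 t₀ ht₀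
    refine ⟨{t ∈ S | eSobolevNorm s (v t - v t₀) < 1},
      eventually_mem_nhdsWithin.and ((hv.2 t₀ ht₀).eventually (eventually_lt_nhds one_pos)),
      eSobolevNorm s (v t₀) + 1, ENNReal.add_lt_top.2 ⟨h₀.2, ENNReal.one_lt_top⟩, ?_⟩
    rintro t ⟨ht, hlt⟩
    have htri : eSobolevNorm s (v t - v t₀ + v t₀) ≤
        eSobolevNorm s (v t - v t₀) + eSobolevNorm s (v t₀) :=
      eSobolevNorm_add_le_holds ((hv.1 t ht).1.sub h₀.1) h₀.1
    rw [sub_add_cancel] at htri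
    calc eSobolevNorm s (v t) ≤ eSobolevNorm s (v t - v t₀) + eSobolevNorm s (v t₀) := htri
      _ ≤ 1 + eSobolevNorm s (v t₀) := add_le_add hlt.le le_rfl
      _ = eSobolevNorm s (v t₀) + 1 := add_comm _ _

/-- Discharge of the named fact `Torus.ContinuousInSobolevOn.memL2Sobolev`:
`C⁰([a,b]; H^s(T^d)) ⊆ L²(a,b; H^s(T^d))`. A continuous-in-time `H^s` family on the compact
interval `[a,b]` is bounded in `H^s` by some `C < ∞`
(`Torus.ContinuousInSobolevOn.exists_forall_eSobolevNorm_le`), so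
`∫_a^b ‖v t‖²_{H^s} dt ≤ C² · |b - a| < ∞`; the a.e.-membership conjunct of `MemL2Sobolev` holds
at *every* `t ∈ (a,b) ⊆ [a,b]` (standard: `C([0,T]; X) ⊆ L^p(0,T; X)` on a bounded interval,
cf. Temam 1995, Part I §§2–3). [folklore] -/
theorem ContinuousInSobolevOn.memL2Sobolev_holds :
    ContinuousInSobolevOn.memL2Sobolev (d := d) (F := F) := by
  intro a b s v hv
  obtain ⟨C, hC, hle⟩ := hv.exists_forall_eSobolevNorm_le isCompact_Icc
  have hint : ∫⁻ t in Ioo a b, eSobolevNorm s (v t) ^ 2 < ∞ :=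
    calc ∫⁻ t in Ioo a b, eSobolevNorm s (v t) ^ 2
        ≤ ∫⁻ _ in Ioo a b, C ^ 2 :=
          setLIntegral_mono measurable_const fun t ht =>
            pow_le_pow_left' (hle t (Ioo_subset_Icc_self ht)) 2
      _ = C ^ 2 * volume (Ioo a b) := setLIntegral_const _ _
      _ < ∞ := ENNReal.mul_lt_top (ENNReal.pow_lt_top hC) measure_Ioo_lt_top
  exact ⟨(ae_restrict_mem measurableSet_Ioo).mono fun t ht => hv.1 t (Ioo_subset_Icc_self ht),
    ENNReal.rpow_lt_top_of_nonneg (by norm_num) hint.ne⟩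

end Torus

end Literature.Analysis.FunctionSpaces
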